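import Mathlib
import Summits.QuantumAdvantage.QuantumAdvantage.Theorems.LinnikCubicClassGroupsPureCubicClassNumberHardStubClassNumberNotDvd
import Summits.QuantumAdvantage.QuantumAdvantage.Theorems.LinnikCubicClassGroupsPureCubicClassNumberHardStubInvariantIdealsPrincipal
import HarnessLib

/-!
# Ambiguous classes one at a time: a fixed class of order `3`, its relation, and Chevalley's step

Route `LinnikCubicClassGroups` (rank-0 hypothesis-type target `PureCubicClassNumberHard`,
stmt-QuantumAdvantage-11826): infrastructure for the Hasse-free DESCENT `3 ∣ h(K(ζ₃)) ⟹ 3 ∣ h(K)`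
of Honda's criterion (`…PureCubicClassNumberHardDescent.lean`).

* `exists_fixed_class_of_three_dvd_card` — for an automorphism `a` with `a³ = 1` of a Dedekind
  domain `R` with `3 ∣ #Cl(R)`: a class `c ≠ 1`, `c³ = 1`, with `[a • I] = [I]` (the class map is a
  group endomorphism `f` with `f³ = 1`, `#Fix(f) ≡ #Cl(R) (mod 3)`, Cauchy on the subgroup `Fix(f)`);
* `exists_rel_of_mk0_smul_eq` — the relation `(x) · aI = (y) · I` of a fixed class and the unit
  `u` with `x · ax · a²x · u = y · ay · a²y` (product of the three conjugate relations);
* `mk0_eq_one_of_rel` — **Chevalley's step for ONE class**: in a cyclic cubic `L/F` with all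
  `σ`-invariant ideals principal, a class with relation `(x) · σI = (y) · I` and `N(y/x) = N(ε)`
  for a unit `ε` is trivial (Hilbert 90; the per-class form of `mk0_eq_one_of_mk0_smul_eq`).

HONEST FRAMING (block-2b rule): kernel-checked classical algebraic number theory, NOT summit
progress; the crux `PureCubicClassNumberHard` is hypothesis-type and untouched.

## References
* T. Honda, *Pure cubic fields whose class numbers are multiples of three*, J. Number Theory 3
  (1971) 7–12. [Honda1971]
* C. Chevalley, *Sur la théorie du corps de classes dans les corps finis et les corps locaux*,
  J. Fac. Sci. Tokyo 2 (1933) (ambiguous classes). [folklore]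
-/

set_option linter.dupNamespace false

open NumberField

open scoped Pointwise NumberField nonZeroDivisors

namespace Summit.QuantumAdvantage.QuantumAdvantage.Theorems.LinnikCubicClassGroups

section ClassMap

variable {M R : Type*} [Group M] [CommRing R] [IsDedekindDomain R] [MulSemiringAction M R]

/-- **A fixed class of order `3`.**  If `a³ = 1` acts on the Dedekind domain `R` and `3` divides
the class number, some ideal class `c ≠ 1` with `c³ = 1` is fixed by `[I] ↦ [a • I]`: the map is a
group endomorphism `f` with `f³ = 1`, so `#Fix(f) ≡ h (mod 3)` (`Equiv.Perm.card_fixedPoints_modEq`)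
and Cauchy's theorem applies to the subgroup `Fix(f)`. [folklore] -/
theorem exists_fixed_class_of_three_dvd_card [Fintype (ClassGroup R)] (a : M) (ha : a ^ 3 = 1)
    (h3 : 3 ∣ Fintype.card (ClassGroup R)) :
    ∃ I : (Ideal R)⁰, ClassGroup.mk0 I ≠ 1 ∧ ClassGroup.mk0 I ^ 3 = 1 ∧
      ClassGroup.mk0 ⟨a • (I : Ideal R), smul_mem_nonZeroDivisors a I⟩ = ClassGroup.mk0 I := by
  classical
  obtain ⟨f, hf⟩ := exists_classMap (R := R) a
  have hf3 : f ^ 3 ^ 1 = 1 := by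
    rw [pow_one]
    funext c
    obtain ⟨I, rfl⟩ := ClassGroup.mk0_surjective c
    show f (f (f (ClassGroup.mk0 I))) = ClassGroup.mk0 I
    rw [hf, hf, hf]
    congr 1
    refine Subtype.ext ?_
    show a • a • a • (I : Ideal R) = I
    rw [smul_smul, smul_smul, ← pow_three', ha, one_smul]
  have hfmul : ∀ c d, f (c * d) = f c * f d := by
    intro c d
    obtain ⟨I, rfl⟩ := ClassGroup.mk0_surjective c
    obtain ⟨J, rfl⟩ := ClassGroup.mk0_surjective d
    rw [← map_mul, hf, hf, hf, ← map_mul]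
    congr 1
    refine Subtype.ext ?_
    show a • ((I : Ideal R) * J) = a • (I : Ideal R) * a • (J : Ideal R)
    exact smul_mul' a _ _
  have hf1 : f 1 = 1 := by
    have h := hfmul 1 1
    rw [one_mul] at h
    exact left_eq_mul.mp h
  let fhom : ClassGroup R →* ClassGroup R := { toFun := f, map_one' := hf1, map_mul' := hfmul }
  let H : Subgroup (ClassGroup R) := MonoidHom.eqLocus fhom (MonoidHom.id _)
  have hmemH : ∀ c, c ∈ H ↔ c ∈ Function.fixedPoints f := fun c => Iff.rfl
  have hcardH : Fintype.card H = Fintype.card (Function.fixedPoints f) :=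
    Fintype.card_congr (Equiv.subtypeEquivRight hmemH)
  have hmod := Equiv.Perm.card_fixedPoints_modEq hf3
  have hdvd : 3 ∣ Fintype.card H := by
    rw [hcardH]
    simp only [Nat.ModEq] at hmod
    omega
  obtain ⟨c, hc⟩ := exists_prime_orderOf_dvd_card 3 hdvd
  have hc' : orderOf (c : ClassGroup R) = 3 := by
    rw [Subgroup.orderOf_coe]
    exact hc
  obtain ⟨I, hI⟩ := ClassGroup.mk0_surjective (c : ClassGroup R)
  refine ⟨I, ?_, ?_, ?_⟩
  · rw [hI]
    intro h1
    rw [h1, orderOf_one] at hc'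
    norm_num at hc'
  · rw [hI, ← hc']
    exact pow_orderOf_eq_one _
  · rw [← hf, hI]
    exact c.2

/-- **The relation of a fixed class.**  If `[a • I] = [I]` with `a³ = 1`, then
`(x) · aI = (y) · I` for nonzero `x, y`, and multiplying the three conjugate relations gives a unit
`u` with `x · ax · a²x · u = y · ay · a²y`. [folklore] -/
theorem exists_rel_of_mk0_smul_eq (a : M) (ha : a ^ 3 = 1) (I : (Ideal R)⁰)
    (h : ClassGroup.mk0 ⟨a • (I : Ideal R), smul_mem_nonZeroDivisors a I⟩ = ClassGroup.mk0 I) :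
    ∃ x y : R, x ≠ 0 ∧ y ≠ 0 ∧ Ideal.span {x} * a • (I : Ideal R) = Ideal.span {y} * I ∧
      ∃ u : Rˣ, x * a • x * a • a • x * u = y * a • y * a • a • y := by
  classical
  obtain ⟨I, hI0⟩ := I
  have hI : I ≠ ⊥ := nonZeroDivisors.ne_zero hI0
  rw [ClassGroup.mk0_eq_mk0_iff] at h
  obtain ⟨x, y, hx, hy, hxy⟩ := h
  change Ideal.span {x} * a • I = Ideal.span {y} * I at hxy
  have haI : a • a • a • I = I := by
    rw [smul_smul, smul_smul, ← pow_three', ha, one_smul]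
  have h1 : Ideal.span {a • x} * a • a • I = Ideal.span {a • y} * a • I := by
    have := congrArg (a • ·) hxy
    simpa only [smul_mul', pointwise_smul_span_singleton] using this
  have h2 : Ideal.span {a • a • x} * I = Ideal.span {a • a • y} * a • a • I := by
    have := congrArg (a • ·) h1
    simpa only [smul_mul', pointwise_smul_span_singleton, haI] using this
  have hII : I * a • I * a • a • I ≠ 0 :=
    mul_ne_zero (mul_ne_zero hI (pointwise_smul_ne_bot a hI))
      (pointwise_smul_ne_bot a (pointwise_smul_ne_bot a hI))
  have hNN : Ideal.span {x * a • x * a • a • x} = Ideal.span {y * a • y * a • a • y} := by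
    apply mul_right_cancel₀ hII
    calc Ideal.span {x * a • x * a • a • x} * (I * a • I * a • a • I)
        = (Ideal.span {x} * a • I) * (Ideal.span {a • x} * a • a • I) *
            (Ideal.span {a • a • x} * I) := by
          rw [← Ideal.span_singleton_mul_span_singleton, ← Ideal.span_singleton_mul_span_singleton]
          ring
      _ = (Ideal.span {y} * I) * (Ideal.span {a • y} * a • I) *
            (Ideal.span {a • a • y} * a • a • I) := by rw [hxy, h1, h2]
      _ = Ideal.span {y * a • y * a • a • y} * (I * a • I * a • a • I) := by
          rw [← Ideal.span_singleton_mul_span_singleton, ← Ideal.span_singleton_mul_span_singleton]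
          ring
  obtain ⟨u, hu⟩ := Ideal.span_singleton_eq_span_singleton.mp hNN
  exact ⟨x, y, hx, hy, hxy, u, hu⟩

end ClassMap

/-! ### Chevalley's step for one class -/

variable {F L : Type*} [Field F] [NumberField F] [Field L] [NumberField L] [Algebra F L]
  [IsGalois F L] {σ : L ≃ₐ[F] L}

/-- **Chevalley's ambiguous-class step, one class at a time.**  Let `L/F` be cyclic cubic with
group `⟨σ⟩` and every nonzero `σ`-invariant ideal of `𝓞 L` principal.  If `(x) · σI = (y) · I`
and `N(y/x) = N(ε)` for a unit `ε` of `𝓞 L`, then `[I] = 1`: by Hilbert 90 `y/x = ε σ(w)/w` with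
`w ∈ 𝓞 L`, and `(σw)(σ²w) · I` is a `σ`-invariant ideal in the class of `I`.  (The proof of
`mk0_eq_one_of_mk0_smul_eq` with its global hypothesis replaced by the one relation used.)
[folklore] -/
theorem mk0_eq_one_of_rel (hσ : ∀ τ : L ≃ₐ[F] L, τ ∈ Subgroup.zpowers σ)
    (h3 : Module.finrank F L = 3)
    (hP : ∀ I : Ideal (𝓞 L), I ≠ ⊥ → σ • I = I → Submodule.IsPrincipal I)
    (I : (Ideal (𝓞 L))⁰) {x y : 𝓞 L} (hx : x ≠ 0) (hy : y ≠ 0)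
    (hxy : Ideal.span {x} * σ • (I : Ideal (𝓞 L)) = Ideal.span {y} * I)
    (ε : (𝓞 L)ˣ) (hε : Algebra.norm F (((ε : 𝓞 L) : L)) = Algebra.norm F ((y : L) / x)) :
    ClassGroup.mk0 I = 1 := by
  classical
  have hσ3 : σ ^ 3 = 1 := pow_three_eq_one_of_finrank_eq_three hσ h3
  obtain ⟨I, hI0⟩ := I
  have hI : I ≠ ⊥ := nonZeroDivisors.ne_zero hI0
  change Ideal.span {x} * σ • I = Ideal.span {y} * I at hxy
  have hx' : (x : L) ≠ 0 := RingOfIntegers.coe_ne_zero_iff.mpr hx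
  have hy' : (y : L) ≠ 0 := RingOfIntegers.coe_ne_zero_iff.mpr hy
  have hε0 : ((ε : 𝓞 L) : L) ≠ 0 := RingOfIntegers.coe_ne_zero_iff.mpr ε.ne_zero
  have hdiv : ∀ a b : L, Algebra.norm F (a / b) = Algebra.norm F a / Algebra.norm F b :=
    fun a b => by rw [div_eq_mul_inv, map_mul, Algebra.norm_inv, div_eq_mul_inv]
  have hz0 : Algebra.norm F ((y : L) / x) ≠ 0 :=
    Algebra.norm_ne_zero_iff.mpr (div_ne_zero hy' hx')
  have h1' : Algebra.norm F ((y : L) / x / ε) = 1 := by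
    rw [hdiv ((y : L) / x), hε, div_self hz0]
  -- Hilbert 90, and an integral representative `w`
  obtain ⟨w₀, hw₀, hw₀'⟩ :=
    Literature.NumberTheory.GaloisRepresentations.CyclicNormIndex.exists_eq_div_of_norm_eq_one
      hσ h1'
  obtain ⟨d, hd, hdint⟩ := exists_integral_multiples ℤ ℚ ({w₀} : Finset L)
  have hdw : IsIntegral ℤ ((d : L) * w₀) := by
    have := hdint w₀ (Finset.mem_singleton_self w₀)
    rwa [Algebra.smul_def, eq_intCast] at this
  set w : 𝓞 L := ⟨(d : L) * w₀, hdw⟩ with hwdef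
  have hw : (w : L) = (d : L) * w₀ := rfl
  have hd' : (d : L) ≠ 0 := Int.cast_ne_zero.mpr hd
  have hwne : (w : L) ≠ 0 := by rw [hw]; exact mul_ne_zero hd' hw₀
  have hwne' : w ≠ 0 := RingOfIntegers.coe_ne_zero_iff.mp hwne
  have hσw : σ (w : L) / w = σ w₀ / w₀ := by
    rw [hw, map_mul, map_intCast, mul_div_mul_left _ _ hd']
  -- `w · y = x · ε · σw` in `𝓞 L`
  have hrel : (w : L) * y = x * (ε * σ (w : L)) := by
    have h := hw₀'.trans hσw.symm
    rw [div_div, div_eq_div_iff (mul_ne_zero hx' hε0) hwne] at h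
    linear_combination h
  have hrelO : w * y = x * ((ε : 𝓞 L) * σ • w) := by
    apply RingOfIntegers.coe_injective
    simp only [map_mul]
    exact hrel
  -- `(w)·σI = (σw)·I`
  have hwI : Ideal.span {w} * σ • I = Ideal.span {σ • w} * I := by
    have hsx : Ideal.span ({x} : Set (𝓞 L)) ≠ 0 := by
      rw [Ne, Ideal.zero_eq_bot, Ideal.span_singleton_eq_bot]
      exact hx
    apply mul_left_cancel₀ hsx
    calc Ideal.span {x} * (Ideal.span {w} * σ • I)
        = Ideal.span {w} * (Ideal.span {x} * σ • I) := by ring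
      _ = Ideal.span {w} * (Ideal.span {y} * I) := by rw [hxy]
      _ = Ideal.span {w * y} * I := by rw [← mul_assoc, Ideal.span_singleton_mul_span_singleton]
      _ = Ideal.span {x * ((ε : 𝓞 L) * σ • w)} * I := by rw [hrelO]
      _ = Ideal.span {x} * (Ideal.span {σ • w} * I) := by
          rw [← Ideal.span_singleton_mul_span_singleton,
            Ideal.span_singleton_mul_left_unit ε.isUnit, mul_assoc]
  -- the invariant ideal `J = (σw)(σ²w)·I` in the class of `I`
  have hσw3 : σ • σ • σ • w = w := by
    rw [smul_smul, smul_smul, ← pow_three', hσ3, one_smul]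
  set J : Ideal (𝓞 L) := Ideal.span {σ • w} * Ideal.span {σ • σ • w} * I with hJ
  have hJσ : σ • J = J := by
    rw [hJ, smul_mul', smul_mul', pointwise_smul_span_singleton, pointwise_smul_span_singleton,
      hσw3, mul_assoc, hwI, ← mul_assoc, mul_comm (Ideal.span {σ • σ • w})]
  have hsw : ∀ t : 𝓞 L, t ≠ 0 → Ideal.span ({t} : Set (𝓞 L)) ≠ ⊥ := fun t ht => by
    rw [Ne, Ideal.span_singleton_eq_bot]
    exact ht
  have hw1 : σ • w ≠ 0 := (smul_ne_zero_iff_ne σ).mpr hwne'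
  have hw2 : σ • σ • w ≠ 0 := (smul_ne_zero_iff_ne σ).mpr hw1
  have hJ0 : J ≠ ⊥ := mul_ne_zero (mul_ne_zero (hsw _ hw1) (hsw _ hw2)) hI
  have hJmem : J ∈ (Ideal (𝓞 L))⁰ := mem_nonZeroDivisors_of_ne_zero hJ0
  have hIJ : ClassGroup.mk0 ⟨I, hI0⟩ = ClassGroup.mk0 ⟨J, hJmem⟩ := by
    rw [ClassGroup.mk0_eq_mk0_iff]
    refine ⟨σ • w * σ • σ • w, 1, mul_ne_zero hw1 hw2, one_ne_zero, ?_⟩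
    show Ideal.span {σ • w * σ • σ • w} * I = Ideal.span {1} * J
    rw [Ideal.span_singleton_one, Ideal.top_mul, hJ, ← Ideal.span_singleton_mul_span_singleton]
  rw [hIJ]
  exact (ClassGroup.mk0_eq_one_iff hJmem).mpr (hP J hJ0 hJσ)

end Summit.QuantumAdvantage.QuantumAdvantage.Theorems.LinnikCubicClassGroups
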